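import Summits.AnomalousDissipation.AnomalousDissipation.Theorems.MarginalStabilityChainChainRealisationReduction
import HarnessLib

/-!
# TRIAGE r2-1 anchors — crux `ChainRealisation` (stmt-AnomalousDissipation-14249)

Kernel-checked companions of `TRIAGE-r2-1.md` (crux-triage round 2, triager 1 of 2, 2026-08-16).
The two payload "ideas" of round 2 (`crux` ← ideator 4, `none` ← ideator 5) are ZERO-CARD reports; the
checks below are this triager's independent re-derivation of (i) the one test that decides admissibility of
any idea for this crux (T1–T4: a residual closes the crux iff it opens door (a) `¬ StrainedLayerLaw` or door
(b) `ChainThesis`; the empty residual closes it iff it is already a theorem) and (ii) the `⊤`-dichotomy that is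
the load-bearing new Lean content of both round-2 reports (T5–T6, re-proved here without importing either
companion): a member of stmt-3007's bare class whose dissipation has an infinite lower integral on one initial
window meets EVERY floor of the exact shape used in `StrainedLayerLaw`, so non-uniqueness ghosts sit on the
TRUE side of 3007 and cannot open door (a).
Nothing here is a line for the crux.
-/

noncomputable section

set_option linter.dupNamespace false

open Set Filter MeasureTheory
open scoped ENNReal Topology

namespace Summit.AnomalousDissipation.AnomalousDissipation.Cruxes.ChainRealisation.Triage2R1

open Summit.AnomalousDissipation.AnomalousDissipation.Theses.MarginalStabilityChain
open Summit.AnomalousDissipation.AnomalousDissipation.Theorems.ChainRealisation.Reduction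

/-! ## T1–T4: the admissibility test -/

/-- T1: the crux today is the two-term implication (3008 and 3009 are theorems; = p111632). [folklore] -/
theorem crux_iff_imp : ChainRealisation ↔ (StrainedLayerLaw → ChainThesis) :=
  chainRealisation_iff_imp

/-- T2: the two doors, and no third. [folklore] -/
theorem crux_iff_not_or : ChainRealisation ↔ (¬ StrainedLayerLaw ∨ ChainThesis) :=
  chainRealisation_iff_not_or

/-- T3: what ANY idea must supply — a residual `R` closes the crux iff, from `R`, one opens door (a) or
door (b). [folklore] -/
theorem residual_closes_iff (R : Prop) :
    (R → ChainRealisation) ↔ (R → ¬ StrainedLayerLaw ∨ ChainThesis) := by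
  rw [chainRealisation_iff_not_or]

/-- T4: the EMPTY idea (no lever: residual `True`) closes the crux iff the crux is already a theorem —
a zero-card report is not a line. [folklore] -/
theorem empty_idea_iff : (True → ChainRealisation) ↔ ChainRealisation :=
  ⟨fun h => h trivial, fun h _ => h⟩

/-- T4′: granted the single-layer law, every residual is worth exactly what it is worth for the route
TARGET stmt-3005 (= p116771 `chainRealisation_residual_iff`). [folklore] -/
theorem residual_iff_target (R : Prop) (h2 : StrainedLayerLaw) :
    (R → ChainRealisation) ↔ (R → ChainThesis) := by
  rw [chainRealisation_iff_chainThesis_of h2]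

/-! ## T5–T6: the `⊤`-dichotomy of the `ℝ≥0∞` Cesàro floor (door (a) cannot be opened by ghosts) -/

/-- T5: an `ℝ≥0∞` density with an infinite lower integral on ONE initial window `(0, b]` has Cesàro
`liminf` equal to `⊤` (monotonicity of the set integral in the set; `ofReal T⁻¹ ≠ 0`). [folklore] -/
theorem cesaro_liminf_top {D : ℝ → ℝ≥0∞} {b : ℝ} (hb : 0 < b) (h : ∫⁻ t in Ioc 0 b, D t = ⊤) :
    liminf (fun T : ℝ => ENNReal.ofReal T⁻¹ * ∫⁻ t in Ioc 0 T, D t) atTop = ⊤ := by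
  have hev : (fun T : ℝ => ENNReal.ofReal T⁻¹ * ∫⁻ t in Ioc 0 T, D t) =ᶠ[atTop]
      fun _ : ℝ => (⊤ : ℝ≥0∞) := by
    filter_upwards [eventually_ge_atTop b] with T hT
    have hTpos : 0 < T := hb.trans_le hT
    have hmono : ∫⁻ t in Ioc 0 b, D t ≤ ∫⁻ t in Ioc 0 T, D t :=
      lintegral_mono_set (Ioc_subset_Ioc_right hT)
    rw [h] at hmono
    have htop : ∫⁻ t in Ioc 0 T, D t = ⊤ := top_unique hmono
    have hne : ENNReal.ofReal T⁻¹ ≠ 0 := (ENNReal.ofReal_pos.2 (inv_pos.2 hTpos)).ne'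
    rw [htop, ENNReal.mul_top hne]
  rw [liminf_congr hev, liminf_const]

/-- T6: hence such a member meets the floor in EXACTLY the shape of `StrainedLayerLaw`'s conclusion
(`ENNReal.ofReal (c * min L 1) ≤ liminf …`), whatever `c` and `L`: ghosts with an infinite-dissipation
window are on the TRUE side of stmt-3007; a refutation of 3007 must make a FINITE-dissipation
(= physical, modulo energy-class uniqueness) member quiet. [folklore] -/
theorem strainedLayer_floor_of_top_window {D : ℝ → ℝ≥0∞} {b : ℝ} (hb : 0 < b)
    (h : ∫⁻ t in Ioc 0 b, D t = ⊤) (c L : ℝ) :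
    ENNReal.ofReal (c * min L 1) ≤
      liminf (fun T : ℝ => ENNReal.ofReal T⁻¹ * ∫⁻ t in Ioc 0 T, D t) atTop := by
  rw [cesaro_liminf_top hb h]
  exact le_top

end Summit.AnomalousDissipation.AnomalousDissipation.Cruxes.ChainRealisation.Triage2R1

end
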